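import Literature.Geometry.Manifold.SubanalyticManifold
import Mathlib.Analysis.SpecialFunctions.Trigonometric.ArctanDeriv
import Mathlib.Geometry.Manifold.ContMDiff.Atlas
import HarnessLib

/-!
# Subanalytic sets: analytic maps near the closure, and transfer along analytic embeddings

Topic `Geometry/Manifold`; sequel to `SubanalyticSets.lean` / `SubanalyticManifold.lean` (Hironaka
1975, Def. 3.3: a subanalytic set is locally a finite Boolean combination of images `f(B)` of
bounded semi-analytic `B ⊆ ℝᵐ` under real-analytic maps). Two pieces of the elementary calculus,
both needed to pass from Buchner's statement "the cut locus is a subanalytic subset of the analytic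
manifold `M`" (1977, p. 121) to a subanalytic subset of a Euclidean space, where Hironaka's
triangulation theorem is stated (programme towards
`Literature.Geometry.Riemannian.buchner1977_cutLocus_triangulable`):

* `exists_analyticOnNhd_onto_ball` — an entire real-analytic map `ψ : ℝⁿ → ℝⁿ`
  (`ψ(x)ᵢ = cᵢ + (2R/π) arctan xᵢ`) onto the open cube `ball c R` of the sup norm, with bounded
  preimages of the smaller closed cubes (the standard reparametrisation making "analytic on a
  neighbourhood of the closure" as good as "entire");
* `IsSemianalytic.isSubanalytic_image_of_analyticOnNhd` — **Hironaka's generators with maps analytic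
  only near `closure B`**: if `B ⊆ ℝᵐ` is bounded semi-analytic and `f` is real-analytic on an open
  set containing `closure B`, then `f(B)` is subanalytic (Hironaka 1975, Def. 3.3 is phrased with
  such maps; the tree's `IsSubanalytic` uses entire maps, and this shows nothing is lost);
* `image_inter_mem_closure_of_injective` — images under an injection, cut down to a subset of the
  range, preserve finite Boolean combinations (set algebra);
* `IsManifoldSubanalytic.isSubanalytic_image` — **transfer along an injective analytic map of a
  compact analytic manifold**: for `ι : M → F` injective and `C^ω` on a compact boundaryless
  real-analytic manifold `M` and `A ⊆ M` subanalytic in `M` (`IsManifoldSubanalytic`), the image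
  `ι(A) ⊆ F` is subanalytic (`IsSubanalytic`). Generators `f(B)` go to generators `(ι ∘ f)(B)`,
  complements in `M` become complements inside the local piece `ι(N)` of `ι(M)`, itself a
  generator through a chart of `M` reparametrised by `ψ`.

No definitions, no named facts (D-0026).

## References

* [Hironaka1975] H. Hironaka, Triangulations of algebraic sets, PSPM 29 (1975), Def. 3.3, Prop. II.
* [BierstoneMilman1988] E. Bierstone, P. D. Milman, Semianalytic and subanalytic sets, Publ. Math.
  IHÉS 67 (1988), §3 (basic properties of subanalytic sets).
* [Buchner1977Simplicial] M. A. Buchner, Proc. AMS 64 (1977), p. 121.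
-/

noncomputable section

open Set Function Filter Metric
open scoped Topology Manifold ContDiff Real

namespace Literature.Geometry.Manifold

/-! ### Cubes of the sup norm are semi-analytic -/

/-- The open ball of the sup norm of `ℝⁿ` (an open cube) is semi-analytic: a finite intersection
of half-spaces `{xᵢ - cᵢ < r}`, `{cᵢ - xᵢ < r}`. [folklore] -/
theorem isSemianalytic_ball_pi {n : ℕ} (c : Fin n → ℝ) {r : ℝ} (hr : 0 < r) :
    IsSemianalytic (ball c r) := by
  have hproj : ∀ i : Fin n, AnalyticOnNhd ℝ (fun x : Fin n → ℝ => x i) univ := fun i x _ =>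
    (ContinuousLinearMap.proj i : (Fin n → ℝ) →L[ℝ] ℝ).analyticAt x
  have h : IsSemianalytic (⋂ i ∈ (Finset.univ : Finset (Fin n)),
      ({x : Fin n → ℝ | x i - c i < r} ∩ {x : Fin n → ℝ | c i - x i < r})) := by
    refine IsSemianalytic.biInter_finset _ fun i _ => ?_
    refine (isSemianalytic_setOf_lt ((hproj i).sub analyticOnNhd_const) analyticOnNhd_const).inter
      (isSemianalytic_setOf_lt (analyticOnNhd_const.sub (hproj i)) analyticOnNhd_const)
  convert h using 1
  ext x
  simp only [mem_ball, mem_iInter, Finset.mem_univ, forall_true_left, mem_inter_iff, mem_setOf_eq]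
  rw [dist_pi_lt_iff hr]
  refine forall_congr' fun i => ?_
  rw [Real.dist_eq, abs_sub_lt_iff]

/-- The closed ball of the sup norm of `ℝⁿ` (a closed cube) is semi-analytic. [folklore] -/
theorem isSemianalytic_closedBall_pi {n : ℕ} (c : Fin n → ℝ) {r : ℝ} (hr : 0 ≤ r) :
    IsSemianalytic (closedBall c r) := by
  have hproj : ∀ i : Fin n, AnalyticOnNhd ℝ (fun x : Fin n → ℝ => x i) univ := fun i x _ =>
    (ContinuousLinearMap.proj i : (Fin n → ℝ) →L[ℝ] ℝ).analyticAt x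
  have h : IsSemianalytic (⋂ i ∈ (Finset.univ : Finset (Fin n)),
      ({x : Fin n → ℝ | x i - c i ≤ r} ∩ {x : Fin n → ℝ | c i - x i ≤ r})) := by
    refine IsSemianalytic.biInter_finset _ fun i _ => ?_
    refine (isSemianalytic_setOf_le ((hproj i).sub analyticOnNhd_const) analyticOnNhd_const).inter
      (isSemianalytic_setOf_le (analyticOnNhd_const.sub (hproj i)) analyticOnNhd_const)
  convert h using 1
  ext x
  simp only [mem_closedBall, mem_iInter, Finset.mem_univ, forall_true_left, mem_inter_iff,
    mem_setOf_eq]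
  rw [dist_pi_le_iff hr]
  refine forall_congr' fun i => ?_
  rw [Real.dist_eq, abs_sub_le_iff]

/-! ### An entire analytic map of `ℝⁿ` onto an open cube -/

/-- **An entire real-analytic map of `ℝⁿ` onto an open cube, with bounded preimages of smaller
closed cubes**: `ψ(x)ᵢ = cᵢ + (2R/π) arctan xᵢ` is real-analytic on `ℝⁿ`, takes values in the open
sup-norm ball `ball c R`, attains every point of it, and `ψ⁻¹(closedBall c r)` is bounded for
`r < R` (it is the cube of half-width `tan(πr/2R)`). [folklore] -/
theorem exists_analyticOnNhd_onto_ball {n : ℕ} (c : Fin n → ℝ) {R : ℝ} (hR : 0 < R) :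
    ∃ ψ : (Fin n → ℝ) → (Fin n → ℝ), AnalyticOnNhd ℝ ψ univ ∧ (∀ x, ψ x ∈ ball c R) ∧
      ball c R ⊆ range ψ ∧ ∀ r < R, Bornology.IsBounded (ψ ⁻¹' closedBall c r) := by
  set a : ℝ := 2 * R / π with ha_def
  have ha : 0 < a := by positivity
  set ψ : (Fin n → ℝ) → (Fin n → ℝ) := fun x i => c i + a * Real.arctan (x i) with hψ_def
  have hψi : ∀ x i, ψ x i = c i + a * Real.arctan (x i) := fun x i => rfl
  -- `|a arctan t| < R`
  have hbound : ∀ t : ℝ, |a * Real.arctan t| < R := by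
    intro t
    rw [abs_mul, abs_of_pos ha]
    have h1 : |Real.arctan t| < π / 2 :=
      abs_lt.2 ⟨Real.neg_pi_div_two_lt_arctan t, Real.arctan_lt_pi_div_two t⟩
    calc a * |Real.arctan t| < a * (π / 2) := by gcongr
      _ = R := by rw [ha_def]; field_simp
  refine ⟨ψ, ?_, ?_, ?_, ?_⟩
  · -- analyticity
    have hψc : ContDiff ℝ ω ψ := by
      refine contDiff_pi.2 fun i => ?_
      exact contDiff_const.add (contDiff_const.mul (Real.contDiff_arctan.comp (contDiff_apply ℝ ℝ i)))
    intro x _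
    exact hψc.contDiffAt.analyticAt
  · -- values in the open cube
    intro x
    rw [mem_ball, dist_pi_lt_iff hR]
    intro i
    rw [Real.dist_eq, hψi, add_sub_cancel_left]
    exact hbound (x i)
  · -- every point of the cube is attained
    intro y hy
    rw [mem_ball, dist_pi_lt_iff hR] at hy
    refine ⟨fun i => Real.tan ((y i - c i) / a), funext fun i => ?_⟩
    have hyi : |y i - c i| < R := by simpa [Real.dist_eq] using hy i
    have hθ : |(y i - c i) / a| < π / 2 := by
      rw [abs_div, abs_of_pos ha, div_lt_iff₀ ha]
      calc |y i - c i| < R := hyi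
        _ = π / 2 * a := by rw [ha_def]; field_simp
    obtain ⟨hθ₁, hθ₂⟩ := abs_lt.1 hθ
    show c i + a * Real.arctan (Real.tan ((y i - c i) / a)) = y i
    rw [Real.arctan_tan hθ₁ hθ₂]
    field_simp
    ring
  · -- bounded preimages of smaller closed cubes
    intro r hr
    by_cases hr0 : r < 0
    · have : ψ ⁻¹' closedBall c r = ∅ := by
        rw [Metric.closedBall_eq_empty.2 hr0, preimage_empty]
      rw [this]
      exact Bornology.isBounded_empty
    push Not at hr0
    set θ₀ : ℝ := r / a with hθ₀_def
    have hθ₀lt : θ₀ < π / 2 := by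
      rw [hθ₀_def, div_lt_iff₀ ha]
      calc r < R := hr
        _ = π / 2 * a := by rw [ha_def]; field_simp
    have hθ₀ge : 0 ≤ θ₀ := div_nonneg hr0 ha.le
    have hθ₀gt : -(π / 2) < θ₀ := lt_of_lt_of_le (by linarith [Real.pi_pos]) hθ₀ge
    set T : ℝ := Real.tan θ₀ with hT_def
    refine (isBounded_closedBall (x := (0 : Fin n → ℝ)) (r := T)).subset fun x hx => ?_
    rw [mem_preimage, mem_closedBall, dist_pi_le_iff hr0] at hx
    have hT0 : 0 ≤ T := Real.tan_nonneg_of_nonneg_of_le_pi_div_two hθ₀ge hθ₀lt.le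
    rw [mem_closedBall, dist_zero_right, pi_norm_le_iff_of_nonneg hT0]
    intro i
    have hxi : |a * Real.arctan (x i)| ≤ r := by
      have h := hx i
      rwa [Real.dist_eq, hψi, add_sub_cancel_left] at h
    rw [abs_mul, abs_of_pos ha, ← le_div_iff₀' ha] at hxi
    -- `|arctan (x i)| ≤ θ₀`, hence `|x i| ≤ tan θ₀`
    obtain ⟨h₁, h₂⟩ := abs_le.1 hxi
    rw [Real.norm_eq_abs, abs_le]
    constructor
    · have h3 : Real.arctan (Real.tan (-θ₀)) ≤ Real.arctan (x i) := by
        rw [Real.arctan_tan (by linarith) (by linarith)]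
        exact h₁
      have h4 := (Real.arctan_strictMono.le_iff_le).1 h3
      rwa [Real.tan_neg] at h4
    · have h3 : Real.arctan (x i) ≤ Real.arctan (Real.tan θ₀) := by
        rw [Real.arctan_tan hθ₀gt hθ₀lt]
        exact h₂
      exact (Real.arctan_strictMono.le_iff_le).1 h3

/-! ### Generators with maps analytic near the closure -/

section Upgrade

variable {E : Type*} [NormedAddCommGroup E] [NormedSpace ℝ E]

/-- **Images of bounded semi-analytic sets under maps real-analytic near their closure are
subanalytic** (Hironaka 1975, Def. 3.3, where the maps `g_α` are real-analytic on a neighbourhood of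
`closure A_α` with `g_α|closure A_α` proper; the tree's `IsSubanalytic` takes entire maps as
generators, and this lemma recovers Hironaka's generality): cover the compact `closure B` by finitely
many cubes `ball x (R/2)` with `ball x R ⊆ Ω`, reparametrise each `ball x R` by the entire map `ψ` of
`exists_analyticOnNhd_onto_ball`; then `f(B ∩ ball x (R/2)) = (f ∘ ψ)(ψ⁻¹(B ∩ ball x (R/2)))` is the
image of a bounded semi-analytic set under the entire analytic map `f ∘ ψ`.
[cite: Hironaka1975, Def. 3.3] -/
theorem IsSemianalytic.isSubanalytic_image_of_analyticOnNhd {m : ℕ} {B : Set (Fin m → ℝ)}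
    (hB : IsSemianalytic B) (hBb : Bornology.IsBounded B) {Ω : Set (Fin m → ℝ)} (hΩ : IsOpen Ω)
    (hBΩ : closure B ⊆ Ω) {f : (Fin m → ℝ) → E} (hf : AnalyticOnNhd ℝ f Ω) :
    IsSubanalytic (f '' B) := by
  classical
  have hK : IsCompact (closure B) := hBb.isCompact_closure
  -- radii `R x > 0` with `ball x (R x) ⊆ Ω` for `x ∈ closure B`
  have hR : ∀ x ∈ closure B, ∃ R > (0 : ℝ), ball x R ⊆ Ω := fun x hx =>
    Metric.isOpen_iff.1 hΩ x (hBΩ hx)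
  choose! R hRpos hRΩ using hR
  -- finite subcover by the half-cubes
  obtain ⟨t, htK, hcover⟩ := hK.elim_nhds_subcover (fun x => ball x (R x / 2))
    fun x hx => ball_mem_nhds x (half_pos (hRpos x hx))
  have hBsub : B ⊆ ⋃ x ∈ t, ball x (R x / 2) := subset_closure.trans hcover
  have hdecomp : f '' B = ⋃ x ∈ t, f '' (B ∩ ball x (R x / 2)) := by
    rw [← image_iUnion₂, ← inter_iUnion₂, inter_eq_self_of_subset_left hBsub]
  rw [hdecomp]
  refine IsSubanalytic.biUnion_finset t fun x hx => ?_
  have hxK : x ∈ closure B := htK x hx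
  have hRx : 0 < R x := hRpos x hxK
  obtain ⟨ψ, hψa, hψball, hψonto, hψbdd⟩ := exists_analyticOnNhd_onto_ball x hRx
  -- the bounded semi-analytic set `ψ⁻¹(B ∩ ball x (R/2))` and the entire map `f ∘ ψ`
  set B₀ : Set (Fin m → ℝ) := ψ ⁻¹' (B ∩ ball x (R x / 2)) with hB₀
  have hB₀s : IsSemianalytic B₀ := (hB.inter (isSemianalytic_ball_pi x (half_pos hRx))).preimage hψa
  have hB₀b : Bornology.IsBounded B₀ :=
    (hψbdd (R x / 2) (half_lt_self hRx)).subset (preimage_mono fun z hz => ball_subset_closedBall hz.2)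
  have hfa : AnalyticOnNhd ℝ (f ∘ ψ) univ := fun z _ =>
    (hf (ψ z) (hRΩ x hxK (hψball z))).comp (hψa z (mem_univ z))
  have himage : (f ∘ ψ) '' B₀ = f '' (B ∩ ball x (R x / 2)) := by
    rw [image_comp, hB₀, image_preimage_eq_of_subset]
    exact fun z hz => hψonto ((ball_subset_ball (half_le_self hRx.le)) hz.2)
  rw [← himage]
  exact isSubanalytic_image hB₀s hB₀b hfa

end Upgrade

/-! ### Boolean combinations under injective maps -/

/-- **Images under an injection, cut down to a piece of the range, preserve Boolean combinations**:
if `B` lies in the Boolean algebra generated by `S` and `R₀ ⊆ range ι`, then `ι(B) ∩ R₀` lies in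
the Boolean algebra generated by `R₀` and the `ι(s)`, `s ∈ S` (unions and `⊥` are preserved by
images; `ι(Bᶜ) ∩ R₀ = R₀ ∖ ι(B)` by injectivity). [folklore] -/
theorem image_inter_mem_closure_of_injective {X Y : Type*} {ι : X → Y} (hι : Injective ι)
    {R₀ : Set Y} (hR₀ : R₀ ⊆ range ι) {S : Set (Set X)} {B : Set X}
    (hB : B ∈ BooleanSubalgebra.closure S) :
    ι '' B ∩ R₀ ∈ BooleanSubalgebra.closure (insert R₀ ((fun s => ι '' s) '' S)) := by
  have hR₀mem : R₀ ∈ BooleanSubalgebra.closure (insert R₀ ((fun s => ι '' s) '' S)) :=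
    BooleanSubalgebra.subset_closure (mem_insert _ _)
  induction hB using BooleanSubalgebra.closure_bot_sup_induction with
  | mem s hs =>
    exact BooleanSubalgebra.inf_mem
      (BooleanSubalgebra.subset_closure (mem_insert_of_mem _ (mem_image_of_mem _ hs))) hR₀mem
  | bot =>
    rw [show ι '' (⊥ : Set X) ∩ R₀ = ⊥ by simp]
    exact BooleanSubalgebra.bot_mem
  | sup s _ t _ hs ht =>
    have heq : ι '' (s ⊔ t) ∩ R₀ = (ι '' s ∩ R₀) ⊔ (ι '' t ∩ R₀) := by
      show ι '' (s ∪ t) ∩ R₀ = (ι '' s ∩ R₀) ∪ (ι '' t ∩ R₀)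
      rw [image_union, union_inter_distrib_right]
    rw [heq]
    exact BooleanSubalgebra.sup_mem hs ht
  | compl s _ hs =>
    have heq : ι '' sᶜ ∩ R₀ = R₀ \ (ι '' s ∩ R₀) := by
      ext y
      constructor
      · rintro ⟨⟨x, hx, rfl⟩, hy⟩
        refine ⟨hy, fun h => hx ?_⟩
        obtain ⟨⟨x', hx', hxx'⟩, -⟩ := h
        rwa [← hι hxx']
      · rintro ⟨hy, hns⟩
        obtain ⟨x, rfl⟩ := hR₀ hy
        refine ⟨⟨x, fun hxs => hns ⟨mem_image_of_mem ι hxs, hy⟩, rfl⟩, hy⟩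
    rw [heq]
    exact BooleanSubalgebra.sdiff_mem hR₀mem hs

/-! ### Transfer along an injective analytic map of a compact analytic manifold -/

section Transfer

variable {E : Type*} [NormedAddCommGroup E] [NormedSpace ℝ E] [FiniteDimensional ℝ E]
  {H : Type*} [TopologicalSpace H] {I : ModelWithCorners ℝ E H} [I.Boundaryless]
  {M : Type*} [TopologicalSpace M] [ChartedSpace H M] [IsManifold I ω M] [CompactSpace M]
  {F : Type*} [NormedAddCommGroup F] [NormedSpace ℝ F]

/-- **Subanalytic subsets of a compact analytic manifold have subanalytic images under injective
analytic maps to a vector space.** Let `M` be a compact boundaryless real-analytic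
manifold, `ι : M → F` injective and `C^ω` (e.g. an analytic embedding in `ℝᴺ`), and `A ⊆ M`
subanalytic in `M` (`IsManifoldSubanalytic`, Hironaka's Def. 3.3 on `M`). Then `ι(A)` is a
subanalytic subset of `F`. At a point `y ∉ ι(M)` the germ of `ι(A)` is empty (`ι(M)` is compact).
At `y = ι(x)`: if `A ∩ U = B ∩ U` with `B` a Boolean combination of generators `f_s(B_s)`
(`f_s : ℝ^{m_s} → M` analytic, `B_s` bounded semi-analytic), choose a chart `φ` at `x`, a linear
isomorphism `L : E ≅ ℝⁿ`, a cube `ball y₀ R` inside `L(φ(U ∩ source))` around `y₀ = L(φ x)` and the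
entire reparametrisation `ψ : ℝⁿ → ball y₀ R` (`exists_analyticOnNhd_onto_ball`); with
`N = φ⁻¹ L⁻¹ (ball y₀ r)`, `r = R/2`, the piece `R₀ = ι(N) = (ι ∘ φ⁻¹ ∘ L⁻¹ ∘ ψ)(ψ⁻¹ ball y₀ r)` is a
generator, `ι(N) = W ∩ ι(M)` for an open `W ∋ y` (`ι` is an embedding), and
`ι(A) ∩ W = ι(B) ∩ R₀`, a Boolean combination of `R₀` and the generators `(ι ∘ f_s)(B_s)`
(`image_inter_mem_closure_of_injective`). This is the passage from Buchner's "the cut locus is a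
subanalytic subset of `M`" to a subanalytic subset of Euclidean space (1977, p. 121, with an
analytic embedding of `M`); cf. Bierstone–Milman 1988, §3. [cite: Buchner1977Simplicial, p. 121] -/
theorem IsManifoldSubanalytic.isSubanalytic_image {ι : M → F} (hι : ContMDiff I 𝓘(ℝ, F) ω ι)
    (hinj : Injective ι) {A : Set M} (hA : IsManifoldSubanalytic I A) :
    IsSubanalytic (ι '' A) := by
  classical
  have hιc : Continuous ι := hι.continuous
  have hemb : Topology.IsClosedEmbedding ι := hιc.isClosedEmbedding hinj
  intro y
  by_cases hy : y ∈ range ι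
  swap
  · -- empty germ off the compact image
    refine ⟨(range ι)ᶜ, hemb.isClosed_range.isOpen_compl, hy, ∅, finite_empty, empty_subset _, ⊥,
      BooleanSubalgebra.bot_mem, ?_⟩
    rw [Set.bot_eq_empty, empty_inter, ← subset_empty_iff]
    rintro z ⟨⟨a, -, rfl⟩, hz⟩
    exact hz (mem_range_self a)
  obtain ⟨x, rfl⟩ := hy
  obtain ⟨U, hU, hxU, S, hSf, hSg, B, hB, hAB⟩ := hA x
  -- chart at `x`, linear coordinates `L : E ≅ ℝⁿ`
  set n : ℕ := Module.finrank ℝ E with hn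
  have hdim : Module.finrank ℝ E = Module.finrank ℝ (Fin n → ℝ) := by rw [Module.finrank_fin_fun]
  set L : E ≃L[ℝ] (Fin n → ℝ) := ContinuousLinearEquiv.ofFinrankEq hdim with hL
  set φ := extChartAt I x with hφ
  -- the open set `O₀ = φ.target ∩ φ⁻¹(U)` of `E` and `O = L(O₀)` of `ℝⁿ`
  set O₀ : Set E := φ.target ∩ φ.symm ⁻¹' U with hO₀
  have hO₀ : IsOpen O₀ :=
    (continuousOn_extChartAt_symm x).isOpen_inter_preimage (isOpen_extChartAt_target x) hU
  set O : Set (Fin n → ℝ) := L.symm ⁻¹' O₀ with hO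
  have hOo : IsOpen O := hO₀.preimage L.symm.continuous
  set y₀ : Fin n → ℝ := L (φ x) with hy₀
  have hy₀O : y₀ ∈ O := by
    show L.symm (L (φ x)) ∈ O₀
    rw [L.symm_apply_apply]
    exact ⟨mem_extChartAt_target x, by
      show φ.symm (φ x) ∈ U
      rw [extChartAt_to_inv]; exact hxU⟩
  obtain ⟨Rr, hRr, hballO⟩ := Metric.isOpen_iff.1 hOo y₀ hy₀O
  set r : ℝ := Rr / 2 with hr
  have hrpos : 0 < r := half_pos hRr
  have hrR : r < Rr := half_lt_self hRr
  obtain ⟨ψ, hψa, hψball, hψonto, hψbdd⟩ := exists_analyticOnNhd_onto_ball y₀ hRr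
  -- the analytic map `g = ι ∘ φ⁻¹ ∘ L⁻¹` on `O' = L⁻¹(φ.target) ⊇ O`, and the entire `G = g ∘ ψ`
  set g : (Fin n → ℝ) → F := fun w => ι (φ.symm (L.symm w)) with hg
  have hga : ∀ w ∈ L.symm ⁻¹' φ.target, AnalyticAt ℝ g w := by
    intro w hw
    have h1 : ContMDiffOn 𝓘(ℝ, E) 𝓘(ℝ, F) ω (ι ∘ φ.symm) φ.target :=
      hι.comp_contMDiffOn (contMDiffOn_extChartAt_symm x)
    have h2 : ContMDiffOn 𝓘(ℝ, Fin n → ℝ) 𝓘(ℝ, F) ω (fun w => ι (φ.symm (L.symm w)))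
        (L.symm ⁻¹' φ.target) :=
      h1.comp (contMDiff_iff_contDiff.2 (L.symm : (Fin n → ℝ) →L[ℝ] E).contDiff).contMDiffOn
        fun w hw => hw
    have h3 : ContDiffOn ℝ ω g (L.symm ⁻¹' φ.target) := contMDiffOn_iff_contDiffOn.1 h2
    have hopen : IsOpen (L.symm ⁻¹' φ.target) := (isOpen_extChartAt_target x).preimage L.symm.continuous
    exact ((h3 w hw).contDiffAt (hopen.mem_nhds hw)).analyticAt
  set G : (Fin n → ℝ) → F := g ∘ ψ with hG
  have hGa : AnalyticOnNhd ℝ G univ := fun z _ =>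
    (hga (ψ z) (hballO (hψball z)).1).comp (hψa z (mem_univ z))
  -- the neighbourhood `N = source ∩ φ⁻¹ L⁻¹ (ball y₀ r)` of `x` in `M`
  set N : Set M := φ.source ∩ φ ⁻¹' (L ⁻¹' ball y₀ r) with hN
  have hNo : IsOpen N :=
    (continuousOn_extChartAt x).isOpen_inter_preimage (isOpen_extChartAt_source x)
      (isOpen_ball.preimage L.continuous)
  have hxN : x ∈ N := ⟨mem_extChartAt_source x, by
    show L (φ x) ∈ ball y₀ r
    exact mem_ball_self hrpos⟩
  have hNU : N ⊆ U := by
    rintro z ⟨hzs, hzb⟩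
    have hzO : L (φ z) ∈ O := hballO (ball_subset_ball hrR.le hzb)
    have hzO₀ : L.symm (L (φ z)) ∈ O₀ := hzO
    rw [L.symm_apply_apply] at hzO₀
    have h := hzO₀.2
    rw [mem_preimage, φ.left_inv hzs] at h
    exact h
  -- `ι(N) = G(ψ⁻¹ ball y₀ r)`, a generator
  set B₀ : Set (Fin n → ℝ) := ψ ⁻¹' ball y₀ r with hB₀
  have hB₀s : IsSemianalytic B₀ := (isSemianalytic_ball_pi y₀ hrpos).preimage hψa
  have hB₀b : Bornology.IsBounded B₀ :=
    (hψbdd r hrR).subset (preimage_mono ball_subset_closedBall)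
  set R₀ : Set F := ι '' N with hR₀
  have hR₀G : R₀ = G '' B₀ := by
    rw [hG, image_comp, hB₀, image_preimage_eq_of_subset
      (fun w hw => hψonto (ball_subset_ball hrR.le hw))]
    ext y'
    constructor
    · rintro ⟨z, ⟨hzs, hzb⟩, rfl⟩
      refine ⟨L (φ z), hzb, ?_⟩
      show ι (φ.symm (L.symm (L (φ z)))) = ι z
      rw [L.symm_apply_apply, φ.left_inv hzs]
    · rintro ⟨w, hw, rfl⟩
      have hwO₀ : L.symm w ∈ O₀ := hballO (ball_subset_ball hrR.le hw)
      have hzt : L.symm w ∈ φ.target := hwO₀.1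
      refine ⟨φ.symm (L.symm w), ⟨φ.map_target hzt, ?_⟩, rfl⟩
      show L (φ (φ.symm (L.symm w))) ∈ ball y₀ r
      rw [φ.right_inv hzt, L.apply_symm_apply]
      exact hw
  -- an open `W ∋ ι x` with `ι⁻¹ W = N`
  obtain ⟨W, hWo, hWN⟩ := hemb.isInducing.isOpen_iff.1 hNo
  have hyW : ι x ∈ W := by
    have : x ∈ ι ⁻¹' W := by rw [hWN]; exact hxN
    exact this
  have hR₀W : R₀ ⊆ W := by
    rw [hR₀, ← hWN]
    exact image_preimage_subset ι W
  -- the generators `ι(s) = (ι ∘ f_s)(B_s)` and `R₀`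
  set S' : Set (Set F) := insert R₀ ((fun s => ι '' s) '' S) with hS'
  refine ⟨W, hWo, hyW, S', (hSf.image _).insert R₀, ?_, ι '' B ∩ R₀,
    image_inter_mem_closure_of_injective hinj (hR₀.symm ▸ image_subset_range ι N) hB, ?_⟩
  · -- admissibility of the generators
    intro s' hs'
    rcases hs' with rfl | ⟨s, hs, rfl⟩
    · exact ⟨n, B₀, G, hB₀s, hB₀b, hGa, hR₀G⟩
    · obtain ⟨m, Bs, f, hBs, hBsb, hf, rfl⟩ := hSg hs
      refine ⟨m, Bs, ι ∘ f, hBs, hBsb, fun z _ => ?_, (image_comp ι f Bs).symm ▸ rfl⟩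
      exact (contMDiff_iff_contDiff.1 (hι.comp hf)).contDiffAt.analyticAt
  · -- the germ identity `ι(A) ∩ W = ι(B) ∩ R₀ (∩ W)`
    have h1 : ι '' A ∩ W = ι '' (A ∩ N) := by rw [← hWN, image_inter_preimage]
    have h2 : A ∩ N = B ∩ N := by
      ext z
      constructor
      · rintro ⟨hzA, hzN⟩
        exact ⟨((hAB.subset : A ∩ U ⊆ B ∩ U) ⟨hzA, hNU hzN⟩).1, hzN⟩
      · rintro ⟨hzB, hzN⟩
        exact ⟨((hAB.symm.subset : B ∩ U ⊆ A ∩ U) ⟨hzB, hNU hzN⟩).1, hzN⟩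
    have h3 : ι '' (B ∩ N) = ι '' B ∩ R₀ := by rw [hR₀, image_inter hinj]
    rw [h1, h2, h3, inter_assoc, inter_eq_self_of_subset_left hR₀W]

end Transfer

end Literature.Geometry.Manifold

end
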